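import Summits.ResolutionOfSingularities.ResolutionOfSingularities.Theorems.WildConesCampaignW46ThreefoldsCharTwoStatement
import Summits.ResolutionOfSingularities.ResolutionOfSingularities.Theorems.WildConesCampaignW46ThreefoldsCharTwo

/-!
# [OURS · L1 W4.6, rung (ii) at p = 2] PROOFS BY NAME of the rung statements
# `CampaignW46ThreefoldsForcedExit 2`, `CampaignW46ThreefoldsNoInfRun 2`, `CampaignW46HypersurfacesMuDrop 2 n`

Cell res-hironaka (LADDER-RESOLUTION rung L, D-0089), slot W4.6, seat res-L1-s46-pv-4; host route `WildCones`,
crux `ClassicalRegimes` (stmt-ResolutionOfSingularities-16884). The statement predicates were typed by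
res-L1-type-o1 (`Theorems/WildConesCampaignW46ThreefoldsCharTwoStatement.lean`, p468935) from this seat's
hand-over; their characteristic-`2` instances are discharged here BY NAME from the rung file
`Theorems/WildConesCampaignW46ThreefoldsCharTwo.lean` (p467896): `threefold_exists_exit_le_mu`,
`threefold_not_infRun`, `muDrop_two`. Everything is OURS, about the route's typed point-blow-up dynamics;
NOTHING is a statement of H. Hironaka's manuscript [Hironaka2017]. No FACT-LIST premise; axioms standard.
AI review is weaker than expert review.

Odd `p` instances of these predicates are NOT claimed here (for `p` odd the hyperbolic-splitting mechanism
is unavailable; the route's odd-`p` engine is `ConeExit`/`NarrowRunsDie`, a different mechanism and a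
different regime).
-/

noncomputable section

-- single-problem summit: the doubled namespace component `ResolutionOfSingularities` is forced
set_option linter.dupNamespace false

namespace Summit.ResolutionOfSingularities.ResolutionOfSingularities.Theorems

/-- [OURS · L1 W4.6 rung (ii) at `p = 2`, PROVED; NOT a statement of the manuscript] **Threefold
hypersurface double points leave the forced regime within `μ(c₀)` point blow-ups** — over every field of
characteristic `2`, for every start `c₀`, chart word and translation word:
`CampaignW46ThreefoldsForcedExit 2`, by `CampaignW46.ThreefoldsCharTwo.threefold_exists_exit_le_mu`. [folklore] -/
theorem campaignW46ThreefoldsForcedExit_two : CampaignW46ThreefoldsForcedExit 2 :=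
  fun κ _ _ c₀ i t => CampaignW46.ThreefoldsCharTwo.threefold_exists_exit_le_mu κ c₀ i t

/-- [OURS · L1 W4.6 rung (ii) at `p = 2`, weak form, PROVED; NOT a statement of the manuscript] **No
infinite forced double run for threefold hypersurfaces in characteristic `2`**:
`CampaignW46ThreefoldsNoInfRun 2`, by `CampaignW46.ThreefoldsCharTwo.threefold_not_infRun`. [folklore] -/
theorem campaignW46ThreefoldsNoInfRun_two : CampaignW46ThreefoldsNoInfRun 2 :=
  fun κ _ _ c₀ i t => CampaignW46.ThreefoldsCharTwo.threefold_not_infRun κ c₀ i t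

/-- [OURS · L1 W4.6 rung (ii) at `p = 2`, one-step (Eq. (127)-role) form, PROVED in EVERY dimension `n`;
NOT a statement of the manuscript] **Strict Milnor drop at every forced double step, characteristic `2`,
every `n`, every field**: `CampaignW46HypersurfacesMuDrop 2 n`, by `CampaignW46.ThreefoldsCharTwo.muDrop_two`.
[cite: GreuelPfister2026, Thm 3.5 and Cor 3.7] -/
theorem campaignW46HypersurfacesMuDrop_two (n : ℕ) : CampaignW46HypersurfacesMuDrop 2 n :=
  fun κ _ _ => CampaignW46.ThreefoldsCharTwo.muDrop_two n κ

end Summit.ResolutionOfSingularities.ResolutionOfSingularities.Theorems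

end
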